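import Summits.AtomisticToContinuum.Crystallization.Theorems.FreeSplittingCertificatesRadiusLadderStar392
import Summits.AtomisticToContinuum.Crystallization.Theorems.FreeSplittingCertificatesRadiusLadderThreshold
import Summits.AtomisticToContinuum.Crystallization.Theorems.FreeSplittingCertificatesRadiusLadderStar563Data

/-!
# `FiniteRangeSplitting` (stmt-AtomisticToContinuum-12559): the non-centrosymmetric star `Star563` —
# a rung with `δ ≤ 19/20`, `R < 19/20` forces `e_∞ ≤ -0.7467779` (conditional refutation)

Support file for crux r2 of route `FreeSplittingCertificates` (block-2b unit `b2b-freesplit-A`, gen 12).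
VALUE = a kernel-checked certificate deciding instances of the crux — NOT summit progress.

`…RadiusLadderStars` refutes the small-radius rungs up to `δ = 23/25` with the lane's radially relaxed fcc star
`Star959` (an `O_h`-symmetric deep site; the relaxed-fcc family crosses the certified floor `B` at `δ ≈ 0.925`).
The tool `not_rungAt_of_deepSite` needs NO symmetry, and deeper sites exist WITHOUT a centre of symmetry: a
Frank–Kasper / Tammes-type first shell of MORE than twelve neighbours at distances `≈ 1.0–1.08` (all its faces
triangles), the second shell in its pockets, and a relaxed seam to a close-packed exterior.  Such a star gains
`≈ 0.08` in `Σ_{|p| ≤ 2} V` over relaxed fcc and loses most of it again beyond (tetrahedrally close-packed continuations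
are `25–30 %` less dense under a hard minimum distance), netting `≈ 0.01–0.02` — at this hard core that still falls short of the certified floor `B`,
and the star is recorded for what it IMPLIES:

* `Star563.sep_conf`, `Star563.centre_half_sum` — the configuration (`563` grid points, data and `decide +kernel`
  certificates in `…RadiusLadderStar563Data*`) is `19/20`-separated and its centre has half pair-sum
  `≤ -1493555850/(2·10⁹) = -0.746777925` — ABOVE the certified floor `B = -0.786477224` (no unconditional refutation
  at this hard core by this star) but far below the conjectured `e_∞ = e_hcp(a*) = -0.7175891`;
* `eInf_le_of_rungAt_19_20` — UNCONDITIONAL: a rung `RungAt δ R` with `δ ≤ 19/20`, `R < 19/20` forces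
  `e_∞ ≤ -0.7467779`; `eInf_le_or_le_halfSumThreshold_19_20` — either that, or `δ_½ ≥ 19/20`;
* `not_rungAt_19_20_of_lt` / `not_rungAt_19_20_of_le` / `radius_ge_19_20_of_feasible_of_le` — the CONDITIONAL
  refutation of every rung `δ ≤ 19/20`, `R < 19/20` under `e_∞ > -0.7467779` (resp. the rounded `e_∞ ≥ -37/50`).
-/

noncomputable section

namespace Summit.AtomisticToContinuum.Crystallization.Theorems.StrictSplittingRuleBirth

open scoped BigOperators Classical
open Literature.MathematicalPhysics.StatisticalMechanics


/-- A grid-distance bound `(19/20)²·10¹⁴ ≤ isq a b` gives `19/20 ≤ dist`. [folklore] -/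
theorem le_dist_pt_19_20 {a b : ℕ × ℕ × ℕ} (h : 90250000000000 ≤ isq a b) : 19 / 20 ≤ dist (pt a) (pt b) := by
  rw [dist_pt]
  apply Real.le_sqrt_of_sq_le
  rw [le_div_iff₀ (by positivity)]
  have h' : ((90250000000000 : ℕ) : ℝ) ≤ (isq a b : ℝ) := by exact_mod_cast h
  push_cast at h'
  nlinarith [h']

namespace Star563

/-- The configuration `x_k = pts[k] / 10⁷`. [folklore] -/
def conf (k : Fin pts.length) : EuclideanSpace ℝ (Fin 3) := pt pts[k.1]

/-- The centre index. [folklore] -/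
def i0 : Fin pts.length := ⟨0, by simp [pts]⟩

/-- The configuration is `19/20`-separated. [folklore] -/
theorem sep_conf : Sep (19 / 20) conf := by
  intro i j hij
  have hp := List.pairwise_iff_getElem.mp pairwise_sep
  rcases lt_or_gt_of_ne (Fin.val_injective.ne hij) with h | h
  · exact le_dist_pt_19_20 (hp i.1 j.1 i.2 j.2 h)
  · rw [dist_comm]
    exact le_dist_pt_19_20 (hp j.1 i.1 j.2 i.2 h)

/-- The centre half pair-sum is `≤ -1493555850 / (2·10⁹) = -0.7467779250` (above `B`: conditional use only).  Per-point bounds by the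
row formula `bOfF`, fed by the centre row of the separation certificate (kept as a local `have`: a separately stated per-point
lemma reads the same in every star file and would be a duplicate declaration). [folklore] -/
theorem centre_half_sum :
    (∑ j ∈ Finset.univ.erase i0, lennardJones (dist (conf i0) (conf j))) / 2 ≤ -(1493555850 : ℝ) / (2 * 10 ^ 9) := by
  have term_le : ∀ a ∈ pts, lennardJones (dist (pt ctr) (pt a)) ≤ -((bOfF (isq ctr a) : ℝ) / 10 ^ 9) := by
    intro a ha
    rcases List.mem_cons.mp ha with rfl | ha'
    · have h1 : isq ctr ctr = 0 := by simp [isq, nd]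
      have h2 : bOfF 0 = 0 := by simp [bOfF]
      rw [dist_self, h1, h2]
      norm_num [lennardJones]
    · have hD := ctr_row a ha'
      have hn : 0 < isq ctr a := lt_of_lt_of_le (by norm_num) hD
      have hrow : 10 ^ 93 ≤ 2 * 10 ^ 51 * isq ctr a ^ 3 :=
        calc (10 : ℕ) ^ 93 ≤ 2 * 10 ^ 51 * 90250000000000 ^ 3 := by norm_num
          _ ≤ 2 * 10 ^ 51 * isq ctr a ^ 3 := Nat.mul_le_mul_left _ (Nat.pow_le_pow_left hD 3)
      rw [dist_pt]
      exact lennardJones_sqrt_le_of_row hn (row_of_bOfF hrow)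
  have h0 : lennardJones (dist (conf i0) (conf i0)) = 0 := by
    rw [dist_self]
    norm_num [lennardJones]
  rw [Finset.sum_erase Finset.univ (f := fun j => lennardJones (dist (conf i0) (conf j))) h0]
  have hle : ∑ j : Fin pts.length, lennardJones (dist (conf i0) (conf j)) ≤
      ∑ j : Fin pts.length, -((bOfF (isq ctr pts[j.1]) : ℝ) / 10 ^ 9) :=
    Finset.sum_le_sum fun j _ => term_le _ (List.getElem_mem j.2)
  have hsum : ∑ j : Fin pts.length, -((bOfF (isq ctr pts[j.1]) : ℝ) / 10 ^ 9) =
      -(((pts.map fun a => bOfF (isq ctr a)).sum : ℕ) : ℝ) / 10 ^ 9 := by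
    rw [← Fin.sum_univ_fun_getElem, Nat.cast_sum, Finset.sum_neg_distrib, ← Finset.sum_div, neg_div]
  rw [hsum, sum_b] at hle
  push_cast at hle
  linarith

end Star563

/-! ## What a rung below `19/20` would cost: the star bound as an implication on `e_∞`

The centre half-sum of `Star563` is `≤ -1493555850/(2·10⁹) = -0.7467779250`, which is ABOVE the tree's certified floor
`B = -0.786477` — so this star refutes nothing unconditionally.  It is recorded as the unconditional implication
"a feasible rule below `19/20` forces `e_∞ ≤ -0.7467779`", i.e. a CONDITIONAL refutation under any hypothesis
`e_∞ > -0.7467779` (the conjectured value is `e_hcp(a*) = -0.7175891`; the tree knows `-0.786477 ≤ e_∞ ≤ -0.7175`). -/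

/-- If the deepest-site inequality `HalfSumFeasible δ` held at some hard core `δ ≤ 19/20`, the ground-state energy per particle
would satisfy `e_∞ ≤ -1493555850/(2·10⁹) ≈ -0.7467779` (evaluate it at the centre of `Star563`). -/
theorem eInf_le_of_halfSumFeasible_19_20 {δ : ℝ} (hδ : δ ≤ 19 / 20) (hf : HalfSumFeasible δ) :
    eInf ≤ -(1493555850 : ℝ) / (2 * 10 ^ 9) :=
  (hf _ Star563.conf (fun i j hij => hδ.trans (Star563.sep_conf i j hij)) Star563.i0).trans Star563.centre_half_sum

/-- **What a small-radius rung at hard core `≤ 19/20` would cost**: a feasible pair-splitting rule with `R < 19/20` at some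
`δ ≤ 19/20` forces `e_∞ ≤ -0.7467779` — a ground state at least `0.029` per particle below the hcp value. Unconditional. -/
theorem eInf_le_of_rungAt_19_20 {δ R : ℝ} (hδ : δ ≤ 19 / 20) (hR : R < 19 / 20) (h : RungAt δ R) :
    eInf ≤ -(1493555850 : ℝ) / (2 * 10 ^ 9) :=
  eInf_le_of_halfSumFeasible_19_20 le_rfl (halfSumFeasible_of_rungAt (by norm_num) hR (rungAt_mono_sep hδ h))

/-- CONDITIONAL refutation, sharpest form: if `e_∞ > -0.7467779` then NO rule with `R < 19/20` is feasible at any hard core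
`δ ≤ 19/20`. -/
theorem not_rungAt_19_20_of_lt (he : -(1493555850 : ℝ) / (2 * 10 ^ 9) < eInf) :
    ∀ δ R : ℝ, δ ≤ 19 / 20 → R < 19 / 20 → ¬ RungAt δ R :=
  fun _ _ hδ hR h => absurd (eInf_le_of_rungAt_19_20 hδ hR h) (not_le.mpr he)

/-- CONDITIONAL refutation, rounded hypothesis: if `e_∞ ≥ -37/50` (implied by the conjectured optimality of hcp with
room `0.0224`), then NO rule with `R < 19/20` is feasible at any hard core `δ ≤ 19/20`. -/
theorem not_rungAt_19_20_of_le (he : -((37 : ℝ) / 50) ≤ eInf) :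
    ∀ δ R : ℝ, δ ≤ 19 / 20 → R < 19 / 20 → ¬ RungAt δ R :=
  not_rungAt_19_20_of_lt (lt_of_lt_of_le (by norm_num) he)

/-- Conditional read-back on crux r2: under `e_∞ ≥ -37/50` every witness `(R, Φ)` at a hard core `δ ≤ 19/20` has `R ≥ 19/20`. -/
theorem radius_ge_19_20_of_feasible_of_le (he : -((37 : ℝ) / 50) ≤ eInf) {δ R : ℝ} (hδ : δ ≤ 19 / 20)
    {Φ : EuclideanSpace ℝ (Fin 3) → Finset (EuclideanSpace ℝ (Fin 3)) → ℝ} (hr : IsRule Φ)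
    (hf : Feasible δ R Φ) : 19 / 20 ≤ R :=
  not_lt.mp fun hR => not_rungAt_19_20_of_le he δ R hδ hR ⟨Φ, hr, hf⟩

/-- Conditionally (`e_∞ > -0.7467779`), the deepest-site inequality fails at every `δ ≤ 19/20` … -/
theorem not_halfSumFeasible_of_le_19_20_of_lt (he : -(1493555850 : ℝ) / (2 * 10 ^ 9) < eInf) {δ : ℝ}
    (h : δ ≤ 19 / 20) : ¬ HalfSumFeasible δ :=
  fun hf => absurd (eInf_le_of_halfSumFeasible_19_20 h hf) (not_le.mpr he)

/-- … so, unconditionally: EITHER `e_∞ ≤ -0.7467779` OR the sharp threshold of `…RadiusLadderThreshold` has `δ_½ ≥ 19/20`. -/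
theorem eInf_le_or_le_halfSumThreshold_19_20 :
    eInf ≤ -(1493555850 : ℝ) / (2 * 10 ^ 9) ∨ (19 : ℝ) / 20 ≤ halfSumThreshold :=
  if he : -(1493555850 : ℝ) / (2 * 10 ^ 9) < eInf then
    Or.inr (le_halfSumThreshold_of_not (not_halfSumFeasible_of_le_19_20_of_lt he le_rfl))
  else Or.inl (not_lt.mp he)


end Summit.AtomisticToContinuum.Crystallization.Theorems.StrictSplittingRuleBirth

end
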